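import Literature.Computability.QuantumComplexity.ZOmegaCodesFPArith
import Literature.Computability.Complexity.CodeFPArith
import HarnessLib

/-!
# `ℤ[ω]` arithmetic as typed polynomial-time maps on codes (`CodeFP`)

Topic `Literature/Computability/QuantumComplexity`, the typed packaging (`CodeFP.lean`:
`CodeFP eα eβ g = ∃ f ∈ FP, ∀ a, f (eα a) = eβ (g a)`) of the `ℤ[ω]` bricks of `ZOmegaCodesFP.lean` /
`ZOmegaCodesFPArith.lean` (`ZWCode.enc`, `zwAddF`, `zwMulF`, `zwConjF`, `zwDivF`, `zwCapF`, the tests, the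
norm parts and the sign test). With the encoder `zwE = ZWCode.enc` (four canonical integer codes,
`intE = dpEnc` of `CodeFPArith.lean`, nested as a `pairE`), every operation of the order `ℤ[ω]` used by
the `p`-blocked simulation of Jozsa–Linden (`Literature/Barriers/QuantumAdvantage/BoundedEntanglement*.lean`)
and by the exact state-vector DP (`StateVectorDP.lean`) becomes a `CodeFP` lemma between
mathematical maps, so that the simulators can be written as ordinary functional programs on `ZW` and
certified by the combinators of `CodeFP.lean` (no string function is written at the use site):

* `zwE`, `zwE_injective`, `zwE_eq_pairE` (the code is the nested pair of the coordinate codes),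
  `zwMk` / `zwCoord k` (assembling / projecting coordinates);
* `zwAdd`, `zwSub`, `zwNeg`, `zwMul` (`ZW.mul`), `zwConj` (`ZW.cconj`), `zwMulOmega`, `zwMulOmegaPow k`;
* `zwDivInt` (`(d, z) ↦ (k ↦ z k / d)`, exact halving when `d = 2^h`), `zwCap`
  (`(x, z) ↦` coordinates of modulus `≥ 2^{|x|}` zeroed);
* `zwIsZero`, `zwEq` (bits), `zwU`, `zwV` (norm parts, integers), `posTest`
  (`(a, b) ↦ [0 < a + b√2]`, `StateVectorDP.posSqrtTwoTest`).

## References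

* S. Arora, B. Barak, *Computational Complexity: A Modern Approach*, CUP 2009, §1.2–1.3.
* R. Jozsa, N. Linden, Proc. R. Soc. Lond. A 459 (2003), §3, lemma `ratlemma` (exact arithmetic in a
  finite extension of `ℚ` is polynomial) — the consumer.
-/

noncomputable section

namespace Literature.Computability.QuantumComplexity

namespace ZWCode

open _root_.Computability Complexity Complexity.Brick Complexity.CodeFP ZW

/-! ### The encoder -/

/-- The code of an element of `ℤ[ω]` as a typed encoder (`= ZWCode.enc`). [folklore] -/
abbrev zwE : ZW → List Bool := enc

/-- `zwE` is injective. [folklore] -/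
theorem zwE_injective : Function.Injective zwE := enc_injective

/-- The code is the nested pair of the four coordinate codes. [folklore] -/
theorem zwE_eq_pairE (z : ZW) :
    zwE z = pairE intE (pairE intE (pairE intE intE)) (z 0, z 1, z 2, z 3) := rfl

/-- **Assembling an element from its four coordinates** (the identity on codes). [folklore] -/
theorem zwMk : CodeFP (pairE intE (pairE intE (pairE intE intE))) zwE (fun t => ![t.1, t.2.1, t.2.2.1, t.2.2.2]) :=
  (CodeFP.id (pairE intE (pairE intE (pairE intE intE)))).recodeOut fun t => by
    obtain ⟨a, b, c, d⟩ := t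
    rfl

/-- **Projecting a coordinate.** [folklore] -/
theorem zwCoord (k : Fin 4) : CodeFP zwE intE (fun z => z k) :=
  of_fn (fld k) (fld_mem_FP k) fun z => fld_enc k z

/-! ### Ring operations -/

/-- Addition. [folklore] -/
theorem zwAdd : CodeFP (pairE zwE zwE) zwE (fun p => p.1 + p.2) :=
  of_fn zwAddF zwAddF_mem_FP fun p => by rw [pairE_apply, zwAddF_boolPair, dec_enc, dec_enc]

/-- Subtraction. [folklore] -/
theorem zwSub : CodeFP (pairE zwE zwE) zwE (fun p => p.1 - p.2) :=
  of_fn zwSubF zwSubF_mem_FP fun p => by rw [pairE_apply, zwSubF_boolPair, dec_enc, dec_enc]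

/-- Negation. [folklore] -/
theorem zwNeg : CodeFP zwE zwE (fun z => -z) :=
  of_fn zwNegF zwNegF_mem_FP fun z => by rw [zwNegF_apply, dec_enc]

/-- **Multiplication** (`ZW.mul`, the product of `ℤ[ω]`). [folklore] -/
theorem zwMul : CodeFP (pairE zwE zwE) zwE (fun p => ZW.mul p.1 p.2) :=
  of_fn zwMulF zwMulF_mem_FP fun p => by rw [pairE_apply, zwMulF_boolPair, dec_enc, dec_enc]

/-- **Complex conjugation** (`ZW.cconj`). [folklore] -/
theorem zwConj : CodeFP zwE zwE ZW.cconj :=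
  of_fn zwConjF zwConjF_mem_FP fun z => by rw [zwConjF_apply, dec_enc]

/-- Multiplication by `ω` (`mulOmega`). [folklore] -/
theorem zwMulOmega : CodeFP zwE zwE mulOmega :=
  of_fn mulOmegaF mulOmegaF_mem_FP fun z => by rw [mulOmegaF_apply, dec_enc]

/-- Multiplication by `ω^k` (`mulOmegaPow k`). [folklore] -/
theorem zwMulOmegaPow (k : ℕ) : CodeFP zwE zwE (mulOmegaPow k) :=
  of_fn (zwPowF k) (zwPowF_mem_FP k) fun z => by rw [zwPowF_apply, dec_enc]

/-! ### Exact division and saturation -/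

/-- **Coordinatewise division by an integer** (`Int.ediv`; with `d = 2^h` this is the exact halving
`ZW.divPow h` of the merge step). [cite: JozsaLinden2003, §3 (proof of lemma ratpbl, Case 2)] -/
theorem zwDivInt : CodeFP (pairE intE zwE) zwE (fun p => fun k => p.2 k / p.1) :=
  of_fn zwDivF zwDivF_mem_FP fun p => by
    rw [pairE_apply, zwDivF_boolPair, dec_enc]
    simp [intE]

/-- **Saturation at a width**: coordinates of modulus `≥ 2^{|x|}` are zeroed. [folklore] -/
theorem zwCap : CodeFP (pairE strE zwE) zwE
    (fun p => fun k => if (p.2 k).natAbs < 2 ^ p.1.length then p.2 k else 0) :=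
  of_fn zwCapF zwCapF_mem_FP fun p => by rw [pairE_apply, zwCapF_boolPair, dec_enc]; rfl

/-! ### Tests, norm parts and the sign test -/

/-- The zero test. [folklore] -/
theorem zwIsZero : CodeFP zwE bitE (fun z => decide (z = 0)) :=
  of_fn zwIsZeroT zwIsZeroT_mem_FP fun z => by rw [zwIsZeroT_apply, dec_enc]; rfl

/-- The equality test. [folklore] -/
theorem zwEq : CodeFP (pairE zwE zwE) bitE (fun p => decide (p.1 = p.2)) :=
  of_fn zwEqT zwEqT_mem_FP fun p => by rw [pairE_apply, zwEqT_boolPair, dec_enc, dec_enc]; rfl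

/-- The rational part `Σ zₖ²` of the squared modulus (`zwU`). [folklore] -/
theorem zwNormU : CodeFP zwE intE zwU :=
  of_fn zwUF zwUF_mem_FP fun z => by rw [zwUF_apply, dec_enc]

/-- The `√2`-part of the squared modulus (`zwV`). [folklore] -/
theorem zwNormV : CodeFP zwE intE zwV :=
  of_fn zwVF zwVF_mem_FP fun z => by rw [zwVF_apply, dec_enc]

/-- **The exact sign test** `(a, b) ↦ [0 < a + b√2]` (`posSqrtTwoTest`). [folklore] -/
theorem posTest : CodeFP (pairE intE intE) bitE (fun p => posSqrtTwoTest p.1 p.2) :=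
  of_fn posTestF posTestF_mem_FP fun p => by
    rw [pairE_apply, posTestF_boolPair]
    simp [intE, bitE]

end ZWCode

end Literature.Computability.QuantumComplexity

end
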